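import Summits.ResolutionOfSingularities.ResolutionOfSingularities.Theorems.FrobeniusClosingPatchingRelPerfectTwoPlanesLevelTwoIdeals
import Summits.ResolutionOfSingularities.ResolutionOfSingularities.Theorems.FrobeniusClosingPatchingRelPerfectConeCubeLevelTwo
import Summits.ResolutionOfSingularities.ResolutionOfSingularities.Theorems.FrobeniusClosingPatchingRelPerfectChartTransversalValues
import HarnessLib

/-!
# Crux `PatchingRelPerfect` (stmt-ResolutionOfSingularities-16161), chain w52 — the rank-two member
# `f = x₀x₁ + x₂³`: the `t`-charts of the plane blow-up are regular (letter tower `(c; t, w)`)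

[OURS · L1 W5.2 · rung, DESIGN STAGE → first regularity brick] Sequel of `…TwoPlanesLevelTwoIdeals`
(this seat's design note NEXT-two-planes-cube.md, kit j282646).  Abstract setting: `A` a regular domain,
the plane centre `Π₀ = V(u, e₀)` (`(u, e₀)` quasi-regular, `A/(u, e₀)` a regular domain), a hypersurface
`V(y)` TRANSVERSAL to it (`y ∉ (u, e₀)`, `A/(u, y)` a regular domain, …) and any `z ∈ A`; on the `e₀`-chart
`C` of `Bl_{(u, e₀)} Spec A` (`u = w t`, `e₀ ↦ w`) the strict transform of `H = e₀ y + u z` is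
`c = ψ y + t ψ z`, and the images of the companion factors `(e₀ y, u)`, `(H) + u(e₀) + (u²)`, `(H) + (u²)`
are `(w)(c, t)`, `(w)(c, w t)`, `(w)(c, w t²)` (`…TwoPlanesLevelTwoIdeals`).  PROVED here: the
hypotheses `H''(C; c, t, w)` of the letter tower `isRegular_of_isBlowup_letterTower`, from the
codimension-two chart bricks (`…ChartTransversal*`: `(c, t) = (t, ψ y)`, `C/(t, ψ y) ≅ A/(u, y)`) and
the exceptional-divisor model `C/(w) ≅ (A/(u, e₀))[X]` (`chartQuotEquiv`, under which `c ↦ ȳ + X z̄`) —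
the three facts about `(A/(u,e₀))[X]/(ȳ + X z̄)` (domain, regular, `X ∉ (ȳ + X z̄)`) are left as
hypotheses, to be discharged on the charts `B₂`, `B₃` where `A/(u, e₀) ≅ κ[e₁, e']`:

* `span_c_t`, `c_notMem_sup`, `w_notMem_span_c_t`, `t_notMem_span_c_w`, `isDomain_quot_span_c_t`,
  `isRegularRing_quot_span_c_t`, `isDomain_quot_span_c_w`, `isRegularRing_quot_span_c_w`,
  `isWeaklyRegular_c_t`, `isWeaklyRegular_c_w`;
* `isRegular_of_isBlowup_tFlag` — every blowing up of `Spec C` along a flag `∏_{s<N} (c, L₀⋯L_s)` with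
  letters in `{t, w, 1}` is regular;
* `isRegular_of_isBlowup_tpProd_t` — hence along the image `(w)³ (c,t)(c,tw)(c,twt)` of
  `(e₀y, u) · ((H) + u(e₀) + (u²)) · ((H) + (u²))`.

Nothing here is a statement of the manuscript under review.

## References

* The Stacks Project, Tags 080A, 080B, 0804, 0BIQ. [StacksProject]
* Q. Liu, *Algebraic Geometry and Arithmetic Curves*, OUP 2002, Thm. 8.1.19 (a). [Liu2002]
* H. Matsumura, *Commutative Ring Theory*, CUP 1986, Thm. 16.2 (i). [Matsumura1987]
-/

-- `Summit.<Summit>.<Sub>.Theorems` with `Sub = Summit` (single-conjunct summit, D-0017)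
set_option linter.dupNamespace false

noncomputable section

open CategoryTheory CategoryTheory.Limits AlgebraicGeometry Literature.AlgebraicGeometry.Resolution
open IsLocalRing

namespace Summit.ResolutionOfSingularities.ResolutionOfSingularities.Theorems

namespace TwoPlanesRung

open ConeRung

universe u

/-- Reordering the three twisted factors. [folklore] -/
theorem tp_flag_product {B : Type*} [CommRing B] (W X1 X2 X3 : Ideal B) :
    W * X1 * (W * X2) * (W * X3) = W ^ 3 * (X1 * X2 * X3) := by
  ring

/-- Letters of the word `(a, b, a)`. [folklore] -/
theorem tp_letters_spec {B : Type*} (a b : B) [One B] (r : ℕ) :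
    [a, b, a].getD r 1 = a ∨ [a, b, a].getD r 1 = b ∨ [a, b, a].getD r 1 = 1 := by
  rcases r with _ | _ | _ | r <;> simp

/-- The flag of the word `(a, b, a)`: `∏_{s<3} (c, L₀⋯L_s) = (c, a)(c, a b)(c, a b a)`. [folklore] -/
theorem tp_flag_three {B : Type*} [CommRing B] (c a b : B) :
    ∏ s ∈ Finset.range 3, Ideal.span {c, ∏ r ∈ Finset.range (s + 1), [a, b, a].getD r 1} =
      Ideal.span {c, a} * Ideal.span {c, a * b} * Ideal.span {c, a * b * a} := by
  simp only [Finset.prod_range_succ, Finset.prod_range_zero, one_mul]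
  rfl

section TChart

variable {A : Type u} [CommRing A] (uu e₀ y z : A)

local notation3 "cc" => (Fin.cons uu (fun _ : Fin 1 => e₀) : Fin 2 → A)
local notation3 "II" => Ideal.span (Set.range (Fin.cons uu (fun _ : Fin 1 => e₀) : Fin 2 → A))
/-- the `e₀`-chart («`t`-chart») `C`, its structure map, exceptional parameter `w`, `t = u/e₀` -/
local notation3 "C" => chartRing cc (Fin.succ 0)
local notation3 "ψ" => chartBase cc (Fin.succ 0)
local notation3 "w" => chartBase cc (Fin.succ 0) (cc (Fin.succ 0))
local notation3 "tt" => chartGen cc (Fin.succ 0) 0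
/-- the strict transform `c = ψ y + t ψ z` of `H = e₀ y + u z` -/
local notation3 "c♯" => chartBase cc (Fin.succ 0) y + chartGen cc (Fin.succ 0) 0 * chartBase cc (Fin.succ 0) z
/-- the polynomial model `(A/(u,e₀))[X]` of the exceptional divisor `C/(w)` and the image of `c` -/
local notation3 "PP" => MvPolynomial {j : Fin 2 // j ≠ Fin.succ 0} (A ⧸ II)
local notation3 "X₀" => (MvPolynomial.X (⟨0, (Fin.succ_ne_zero 0).symm⟩ : {j : Fin 2 // j ≠ Fin.succ 0}) :
  MvPolynomial {j : Fin 2 // j ≠ Fin.succ 0} (A ⧸ II))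
local notation3 "g♭" => (MvPolynomial.C (Ideal.Quotient.mk II y) : MvPolynomial {j : Fin 2 // j ≠ Fin.succ 0} (A ⧸ II))
  + MvPolynomial.X (⟨0, (Fin.succ_ne_zero 0).symm⟩ : {j : Fin 2 // j ≠ Fin.succ 0}) *
    MvPolynomial.C (Ideal.Quotient.mk II z)

/-! ### Ideal bookkeeping -/

/-- `(c, t) = (t, ψ y)` since `c ≡ ψ y (mod t)`. [folklore] -/
theorem span_c_t : Ideal.span {c♯, tt} = Ideal.span {tt, ψ y} :=
  span_pair_add_mul_right tt (ψ y) (ψ z)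

/-- `w` is a non-zero-divisor of the chart. [cite: StacksProject, Tag 0804] -/
theorem w_mem_nonZeroDivisors : w ∈ nonZeroDivisors C :=
  reesChartBase_mem_nonZeroDivisors (cc (Fin.succ 0))
    (Ideal.mem_span_range_self (f := cc) (x := Fin.succ 0))

/-- `ψ y ∉ (w) + (t)` (`ȳ ≠ 0` on the old centre). [cite: StacksProject, Tag 0BIQ] -/
theorem psi_y_notMem_sup (hc : IsQuasiRegular cc) [IsDomain (A ⧸ II)] (hy : y ∉ II) : ψ y ∉ Ideal.span {w} ⊔ Ideal.span {tt} :=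
  chartBase_notMem_span_pair_chartFamily uu e₀ y hc hy

/-- `c ∉ (w) + (t)`. [folklore] -/
theorem c_notMem_sup (hc : IsQuasiRegular cc) [IsDomain (A ⧸ II)] (hy : y ∉ II) : c♯ ∉ Ideal.span {w} ⊔ Ideal.span {tt} := by
  intro h
  apply psi_y_notMem_sup uu e₀ y hc hy
  have e : ψ y = c♯ - tt * ψ z := by ring
  rw [e]
  exact Ideal.sub_mem _ h (Ideal.mem_sup_right (Ideal.mul_mem_right _ _ (Ideal.mem_span_singleton_self _)))

/-- `c ∉ (w)`. [folklore] -/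
theorem c_notMem_span_w (hc : IsQuasiRegular cc) [IsDomain (A ⧸ II)] (hy : y ∉ II) : c♯ ∉ Ideal.span {w} :=
  fun h => c_notMem_sup uu e₀ y z hc hy (Ideal.mem_sup_left h)

/-- `c ∉ (t)`. [folklore] -/
theorem c_notMem_span_t (hc : IsQuasiRegular cc) [IsDomain (A ⧸ II)] (hy : y ∉ II) : c♯ ∉ Ideal.span {tt} :=
  fun h => c_notMem_sup uu e₀ y z hc hy (Ideal.mem_sup_right h)

/-- `w ∉ (c, t)` (`= (t) + (ψ y)`; brick 4: `e₀ ∉ (u) + (y)`). [folklore] -/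
theorem w_notMem_span_c_t (hc : IsQuasiRegular cc) [IsDomain (A ⧸ II)] [IsDomain (A ⧸ Ideal.span {uu})]
    (he : e₀ ∉ Ideal.span {uu}) (heuy : e₀ ∉ Ideal.span {uu} ⊔ Ideal.span {y}) :
    w ∉ Ideal.span {c♯, tt} := by
  rw [span_c_t, Ideal.span_insert]
  exact transv_chartBase_notMem_pair uu e₀ y hc he heuy

/-! ### The chart and its quotients -/

/-- The chart is a domain. [cite: StacksProject, Tag 0804] -/
theorem isDomain_chart [IsDomain A] (he : e₀ ∉ Ideal.span {uu}) : IsDomain C :=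
  strictExc_isDomain_chart uu (fun _ : Fin 1 => e₀) 0
    (strictExc_ne_zero uu (fun _ : Fin 1 => e₀) 0 he)

/-- `C ⧸ (c, t)` is a domain (`≅ A/(u, y)`). [cite: StacksProject, Tag 0804] -/
theorem isDomain_quot_span_c_t (hc : IsQuasiRegular cc) [IsDomain (A ⧸ II)] [IsDomain (A ⧸ Ideal.span {uu})]
    (hdy : IsDomain (A ⧸ Ideal.span {uu, y})) (he : e₀ ∉ Ideal.span {uu}) :
    IsDomain (C ⧸ Ideal.span {c♯, tt}) := by
  rw [span_c_t]
  haveI := hdy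
  exact transv_isDomain_quot_pair uu e₀ y hc he

/-- `C ⧸ (c, t)` is a regular ring (`≅ A/(u, y)`). [cite: StacksProject, Tag 0804] -/
theorem isRegularRing_quot_span_c_t (hc : IsQuasiRegular cc) [IsDomain (A ⧸ II)] [IsDomain (A ⧸ Ideal.span {uu})]
    (hry : IsRegularRing (A ⧸ Ideal.span {uu, y})) (he : e₀ ∉ Ideal.span {uu}) :
    IsRegularRing (C ⧸ Ideal.span {c♯, tt}) := by
  rw [span_c_t]
  haveI := hry
  exact transv_isRegularRing_quot_pair uu e₀ y hc he

/-- The value of the exceptional-divisor model on `g♭ = ȳ + X z̄`: it is the class of `c`. [folklore] -/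
theorem chartQuotEquiv_gFlat (hc : IsQuasiRegular cc) :
    chartQuotEquiv cc (Fin.succ 0) hc g♭ = Ideal.Quotient.mk (Ideal.span {w}) c♯ := by
  rw [chartQuotEquiv_apply, map_add, map_mul, chartQuotMap_C, chartQuotMap_C, chartQuotMap_X]
  simp only [map_add, map_mul]

/-- The value on `X`: the class of `t`. [folklore] -/
theorem chartQuotEquiv_X (hc : IsQuasiRegular cc) :
    chartQuotEquiv cc (Fin.succ 0) hc X₀ = Ideal.Quotient.mk (Ideal.span {w}) tt := by
  rw [chartQuotEquiv_apply, chartQuotMap_X]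

/-- `(c, w) ↦ (class of c)` modulo `w`. [folklore] -/
theorem map_mk_span_c_w (hc : IsQuasiRegular cc) :
    (Ideal.span {c♯}).map (Ideal.Quotient.mk (Ideal.span {w})) =
      (Ideal.span {g♭}).map (chartQuotEquiv cc (Fin.succ 0) hc : PP →+* C ⧸ Ideal.span {w}) := by
  rw [Ideal.map_span, Set.image_singleton, Ideal.map_span, Set.image_singleton]
  exact congrArg (fun q => Ideal.span {q}) (chartQuotEquiv_gFlat uu e₀ y z hc).symm

/-- **`C ⧸ (c, w) ≅ (A/(u,e₀))[X] ⧸ (ȳ + X z̄)`.** [cite: StacksProject, Tag 0BIQ] -/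
theorem nonempty_quot_span_c_w_equiv (hc : IsQuasiRegular cc) :
    Nonempty ((PP ⧸ Ideal.span {g♭}) ≃+* (C ⧸ Ideal.span {c♯, w})) := by
  let e := chartQuotEquiv cc (Fin.succ 0) hc
  let e1 : (PP ⧸ Ideal.span {g♭}) ≃+*
      ((C ⧸ Ideal.span {w}) ⧸ (Ideal.span {c♯}).map (Ideal.Quotient.mk (Ideal.span {w}))) :=
    Ideal.quotientEquiv (Ideal.span {g♭}) _ e (map_mk_span_c_w uu e₀ y z hc)
  let e2 : ((C ⧸ Ideal.span {w}) ⧸ (Ideal.span {c♯}).map (Ideal.Quotient.mk (Ideal.span {w}))) ≃+*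
      (C ⧸ (Ideal.span {w} ⊔ Ideal.span {c♯})) :=
    DoubleQuot.quotQuotEquivQuotSup (Ideal.span {w}) (Ideal.span {c♯})
  have hsup : Ideal.span {w} ⊔ Ideal.span {c♯} = Ideal.span {c♯, w} := by
    rw [Ideal.span_insert, sup_comm]
  exact ⟨(e1.trans e2).trans (Ideal.quotEquivOfEq hsup)⟩

/-- `C ⧸ (c, w)` is a domain when `(A/(u,e₀))[X] ⧸ (ȳ + X z̄)` is. [cite: StacksProject, Tag 0BIQ] -/
theorem isDomain_quot_span_c_w (hc : IsQuasiRegular cc) (hPd : IsDomain (PP ⧸ Ideal.span {g♭})) :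
    IsDomain (C ⧸ Ideal.span {c♯, w}) := by
  obtain ⟨e⟩ := nonempty_quot_span_c_w_equiv uu e₀ y z hc
  exact MulEquiv.isDomain (PP ⧸ Ideal.span {g♭}) e.symm.toMulEquiv

/-- `C ⧸ (c, w)` is a regular ring when `(A/(u,e₀))[X] ⧸ (ȳ + X z̄)` is. [cite: StacksProject, Tag 0BIQ] -/
theorem isRegularRing_quot_span_c_w (hc : IsQuasiRegular cc) (hPr : IsRegularRing (PP ⧸ Ideal.span {g♭})) :
    IsRegularRing (C ⧸ Ideal.span {c♯, w}) := by
  obtain ⟨e⟩ := nonempty_quot_span_c_w_equiv uu e₀ y z hc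
  exact IsRegularRing.of_ringEquiv (R := PP ⧸ Ideal.span {g♭}) e

/-- `t ∉ (c, w)` when `X ∉ (ȳ + X z̄)`. [folklore] -/
theorem t_notMem_span_c_w (hc : IsQuasiRegular cc) (hPX : X₀ ∉ Ideal.span {g♭}) : tt ∉ Ideal.span {c♯, w} := by
  intro h
  apply hPX
  have h1 : Ideal.Quotient.mk (Ideal.span {w}) tt ∈
      (Ideal.span {c♯, w}).map (Ideal.Quotient.mk (Ideal.span {w})) := Ideal.mem_map_of_mem _ h
  have h2 : (Ideal.span {c♯, w}).map (Ideal.Quotient.mk (Ideal.span {w})) =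
      Ideal.span {Ideal.Quotient.mk (Ideal.span {w}) c♯} := by
    have h0 : Ideal.Quotient.mk (Ideal.span {w}) w = 0 :=
      Ideal.Quotient.eq_zero_iff_mem.mpr (Ideal.mem_span_singleton_self _)
    rw [Ideal.span_insert, Ideal.map_sup, Ideal.map_span, Set.image_singleton, Ideal.map_span,
      Set.image_singleton, h0, Ideal.span_singleton_eq_bot.mpr rfl, sup_bot_eq]
  rw [h2, ← chartQuotEquiv_X uu e₀ hc, ← chartQuotEquiv_gFlat uu e₀ y z hc,
    Ideal.mem_span_singleton'] at h1
  obtain ⟨a, ha⟩ := h1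
  rw [Ideal.mem_span_singleton']
  refine ⟨(chartQuotEquiv cc (Fin.succ 0) hc).symm a, (chartQuotEquiv cc (Fin.succ 0) hc).injective ?_⟩
  rw [map_mul, RingEquiv.apply_symm_apply, ha]

/-! ### The pairs `(c, t)` and `(c, w)` -/

/-- `(ψ y, t)` is weakly regular (brick 1, transversal hypersurface). [cite: Matsumura1987, Thm. 16.2 (i)] -/
theorem isWeaklyRegular_psiy_t (hc : IsQuasiRegular cc) [IsDomain A] [IsDomain (A ⧸ II)] [IsDomain (A ⧸ Ideal.span {y})]
    [IsDomain (A ⧸ (II ⊔ Ideal.span {y}))] (hy : y ∉ II) (hey : e₀ ∉ Ideal.span {y}) :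
    RingTheory.Sequence.IsWeaklyRegular C (List.ofFn (Fin.cons (ψ y) fun _ : Fin 1 => tt)) :=
  transv_isWeaklyRegular_pair uu (fun _ : Fin 1 => e₀) 0 y hc hy hey

/-- `t`, `ψ y`, `c` are non-zero-divisors of the domain `C`. [folklore] -/
theorem mem_nonZeroDivisors_three (hc : IsQuasiRegular cc) [IsDomain A] [IsDomain (A ⧸ II)] (hy : y ∉ II)
    (he : e₀ ∉ Ideal.span {uu}) :
    tt ∈ nonZeroDivisors C ∧ ψ y ∈ nonZeroDivisors C ∧ c♯ ∈ nonZeroDivisors C := by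
  haveI : IsDomain C := isDomain_chart uu e₀ he
  haveI : NoZeroDivisors C := IsDomain.to_noZeroDivisors (chartRing cc (Fin.succ 0))
  refine ⟨mem_nonZeroDivisors_of_ne_zero fun h0 => ?_, mem_nonZeroDivisors_of_ne_zero fun h0 => ?_,
    mem_nonZeroDivisors_of_ne_zero fun h0 => ?_⟩
  · exact strictExc_chartGen_notMem_span uu (fun _ : Fin 1 => e₀) 0 hc (by rw [h0]; exact Ideal.zero_mem _)
  · exact psi_y_notMem_sup uu e₀ y hc hy (by rw [h0]; exact Ideal.zero_mem _)
  · exact c_notMem_sup uu e₀ y z hc hy (by rw [h0]; exact Ideal.zero_mem _)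

/-- **`(c, t)` is weakly regular**: `(ψ y, t)` is, swap, perturb `ψ y ↦ ψ y + t ψ z = c`, swap.
[cite: Matsumura1987, Thm. 16.2 (i)] -/
theorem isWeaklyRegular_c_t (hc : IsQuasiRegular cc) [IsDomain A] [IsDomain (A ⧸ II)] [IsDomain (A ⧸ Ideal.span {y})]
    [IsDomain (A ⧸ (II ⊔ Ideal.span {y}))] (hy : y ∉ II) (hey : e₀ ∉ Ideal.span {y})
    (he : e₀ ∉ Ideal.span {uu}) :
    RingTheory.Sequence.IsWeaklyRegular C (List.ofFn (Fin.cons c♯ fun _ : Fin 1 => tt)) := by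
  obtain ⟨ht0, hy0, hc0⟩ := mem_nonZeroDivisors_three uu e₀ y z hc hy he
  have h1 := isWeaklyRegular_pair_swap _ _ hy0 ht0 (isWeaklyRegular_psiy_t uu e₀ y hc hy hey)
  have h2 : RingTheory.Sequence.IsWeaklyRegular C (List.ofFn (Fin.cons tt fun _ : Fin 1 => c♯)) :=
    isWeaklyRegular_pair_of_add_mul _ _ (ψ z) h1
  exact isWeaklyRegular_pair_swap _ _ ht0 hc0 h2

/-- **`(c, w)` is weakly regular**: `w` is a non-zero-divisor, `c̄ ≠ 0` in the domain `C/(w)`, swap.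
[cite: Matsumura1987, Thm. 16.2 (i)] -/
theorem isWeaklyRegular_c_w (hc : IsQuasiRegular cc) [IsDomain A] [IsDomain (A ⧸ II)] (hy : y ∉ II) (he : e₀ ∉ Ideal.span {uu}) :
    RingTheory.Sequence.IsWeaklyRegular C (List.ofFn (Fin.cons c♯ fun _ : Fin 1 => w)) := by
  obtain ⟨-, -, hc0⟩ := mem_nonZeroDivisors_three uu e₀ y z hc hy he
  haveI : IsDomain (C ⧸ Ideal.span {w}) := isDomain_chartRing_quot_span cc (Fin.succ 0) hc
  have hmk : Ideal.Quotient.mk (Ideal.span {w}) c♯ ∈ nonZeroDivisors (C ⧸ Ideal.span {w}) :=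
    mem_nonZeroDivisors_of_ne_zero fun h0 =>
      c_notMem_span_w uu e₀ y z hc hy (Ideal.Quotient.eq_zero_iff_mem.mp h0)
  have h1 : RingTheory.Sequence.IsWeaklyRegular C (List.ofFn (Fin.cons w fun _ : Fin 1 => c♯)) :=
    (isWeaklyRegular_pair_iff _ _).mpr
      ⟨((isRegular_iff_mem_nonZeroDivisors).mpr (w_mem_nonZeroDivisors uu e₀)).left.isSMulRegular,
        isSMulRegular_quotient_of_mem_nonZeroDivisors _ _ hmk⟩
  exact isWeaklyRegular_pair_swap _ _ (w_mem_nonZeroDivisors uu e₀) hc0 h1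

/-! ### The letter tower on the `t`-chart -/

/-- **The letter tower on the `t`-chart for ANY word in `{t, w, 1}`**: `H''(C; c, t, w)` is discharged
by the lemmas above, so every blowing up of `Spec C` along `∏_{s<N} (c, L₀⋯L_s)` is regular.
[cite: StacksProject, Tag 080A] [cite: Liu2002, Thm. 8.1.19 (a)] [cite: Matsumura1987, Thm. 16.2 (i)] -/
theorem isRegular_of_isBlowup_tFlag (hc : IsQuasiRegular cc) (N : ℕ) [IsDomain A] [IsRegularRing A]
    [IsDomain (A ⧸ II)] [IsRegularRing (A ⧸ II)] [IsDomain (A ⧸ Ideal.span {uu})]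
    [IsDomain (A ⧸ Ideal.span {y})] [IsDomain (A ⧸ (II ⊔ Ideal.span {y}))]
    (hdy : IsDomain (A ⧸ Ideal.span {uu, y})) (hry : IsRegularRing (A ⧸ Ideal.span {uu, y}))
    (hy : y ∉ II) (hey : e₀ ∉ Ideal.span {y}) (he : e₀ ∉ Ideal.span {uu})
    (heuy : e₀ ∉ Ideal.span {uu} ⊔ Ideal.span {y})
    (hPd : IsDomain (PP ⧸ Ideal.span {g♭})) (hPr : IsRegularRing (PP ⧸ Ideal.span {g♭}))
    (hPX : X₀ ∉ Ideal.span {g♭})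
    (L : ℕ → C) (hL : ∀ r, L r = tt ∨ L r = w ∨ L r = 1)
    {Y : Scheme.{u}} {ρ : Y ⟶ Spec (.of C)}
    (hρ : IsBlowup ρ (affineBlowup.idealSheaf (∏ s ∈ Finset.range N,
      Ideal.span {c♯, ∏ r ∈ Finset.range (s + 1), L r}))) :
    Scheme.IsRegular Y := by
  haveI : IsRegularRing C := isRegularRing_blowupChart cc (Fin.succ 0) hc
  haveI : IsDomain C := isDomain_chart uu e₀ he
  obtain ⟨ht0, -, -⟩ := mem_nonZeroDivisors_three uu e₀ y z hc hy he
  have hct := isWeaklyRegular_c_t uu e₀ y z hc hy hey he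
  have hcw := isWeaklyRegular_c_w uu e₀ y z hc hy he
  exact isRegular_of_isBlowup_letterTower N c♯ tt w L hL
    (isQuasiRegular_of_isWeaklyRegular _ hct) (isQuasiRegular_of_isWeaklyRegular _ hcw)
    (isDomain_quot_span_c_t uu e₀ y z hc hdy he) (isRegularRing_quot_span_c_t uu e₀ y z hc hry he)
    (isDomain_quot_span_c_w uu e₀ y z hc hPd) (isRegularRing_quot_span_c_w uu e₀ y z hc hPr)
    ((isWeaklyRegular_pair_iff _ _).mp hct).2 ((isWeaklyRegular_pair_iff _ _).mp hcw).2
    (nonZeroDivisors.ne_zero ht0) (w_notMem_span_c_t uu e₀ y z hc he heuy)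
    (t_notMem_span_c_w uu e₀ y z hc hPX) hρ

/-- The image of the three companion factors on the `t`-chart, flag form:
`(w)³ · (c, t)(c, t w)(c, t w t)`. [cite: StacksProject, Tag 080B] -/
theorem map_tpProd_t :
    (Ideal.span {e₀ * y, uu} *
        (Ideal.span {e₀ * y + uu * z} ⊔ Ideal.span {uu} * Ideal.span {e₀} ⊔ Ideal.span {uu} ^ 2) *
        (Ideal.span {e₀ * y + uu * z} ⊔ Ideal.span {uu} ^ 2)).map ψ =
      Ideal.span {w} ^ 3 * ∏ s ∈ Finset.range 3,
        Ideal.span {c♯, ∏ r ∈ Finset.range (s + 1), [tt, w, tt].getD r 1} := by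
  have h3 : (Ideal.span {e₀ * y, uu}).map ψ = Ideal.span {w} * Ideal.span {c♯, tt} :=
    map_tpA3_t uu e₀ y z
  have h4 : (Ideal.span {e₀ * y + uu * z} ⊔ Ideal.span {uu} * Ideal.span {e₀} ⊔
      Ideal.span {uu} ^ 2).map ψ = Ideal.span {w} * Ideal.span {c♯, w * tt} :=
    map_tpA4_t uu e₀ y z
  have hK : (Ideal.span {e₀ * y + uu * z} ⊔ Ideal.span {uu} ^ 2).map ψ =
      Ideal.span {w} * Ideal.span {c♯, w * tt ^ 2} :=
    map_tpK_t uu e₀ y z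
  rw [Ideal.map_mul, Ideal.map_mul, h3, h4, hK, tp_flag_product]
  simp only [Finset.prod_range_succ, Finset.prod_range_zero, one_mul, List.getD_cons_zero,
    List.getD_cons_succ]
  rw [show tt * w * tt = w * tt ^ 2 by ring, show tt * w = w * tt from mul_comm tt w]

/-- **The `t`-chart of the plane blow-up is resolved by the companion factors**: every blowing up of
`Spec C` along the image of `(e₀y, u) · ((H) + u(e₀) + (u²)) · ((H) + (u²))` is regular (twist off
`(w)³`, Stacks 080B, then the letter tower with the word `(t, w, t)`).
[cite: StacksProject, Tag 080A] [cite: StacksProject, Tag 080B] [cite: Liu2002, Thm. 8.1.19 (a)] -/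
theorem isRegular_of_isBlowup_tpProd_t (hc : IsQuasiRegular cc) [IsDomain A] [IsRegularRing A]
    [IsDomain (A ⧸ II)] [IsRegularRing (A ⧸ II)] [IsDomain (A ⧸ Ideal.span {uu})]
    [IsDomain (A ⧸ Ideal.span {y})] [IsDomain (A ⧸ (II ⊔ Ideal.span {y}))]
    (hdy : IsDomain (A ⧸ Ideal.span {uu, y})) (hry : IsRegularRing (A ⧸ Ideal.span {uu, y}))
    (hy : y ∉ II) (hey : e₀ ∉ Ideal.span {y}) (he : e₀ ∉ Ideal.span {uu})
    (heuy : e₀ ∉ Ideal.span {uu} ⊔ Ideal.span {y})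
    (hPd : IsDomain (PP ⧸ Ideal.span {g♭})) (hPr : IsRegularRing (PP ⧸ Ideal.span {g♭}))
    (hPX : X₀ ∉ Ideal.span {g♭})
    {Y : Scheme.{u}} {ρ : Y ⟶ Spec (.of C)}
    (hρ : IsBlowup ρ (affineBlowup.idealSheaf ((Ideal.span {e₀ * y, uu} *
        (Ideal.span {e₀ * y + uu * z} ⊔ Ideal.span {uu} * Ideal.span {e₀} ⊔ Ideal.span {uu} ^ 2) *
        (Ideal.span {e₀ * y + uu * z} ⊔ Ideal.span {uu} ^ 2)).map ψ))) :
    Scheme.IsRegular Y := by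
  have hw3 : w ^ 3 ∈ nonZeroDivisors C := pow_mem (w_mem_nonZeroDivisors uu e₀) 3
  rw [map_tpProd_t uu e₀ y z, Ideal.span_singleton_pow] at hρ
  exact CoreRungTower.isRegular_of_isBlowup_span_singleton_mul hw3 _
    (fun Y' ρ' h' => isRegular_of_isBlowup_tFlag uu e₀ y z hc 3 hdy hry hy hey he heuy hPd hPr hPX
      (fun r => [tt, w, tt].getD r 1) (tp_letters_spec tt w) h') hρ

end TChart

end TwoPlanesRung

end Summit.ResolutionOfSingularities.ResolutionOfSingularities.Theorems

end
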